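import Mathlib
import HarnessLib
import Summits.QuantumFields.YangMills.Theorems.MirrorModularBoostsHypercubicLimitConvergenceSubseq
import Summits.QuantumFields.YangMills.Theorems.MirrorModularBoostsHypercubicLimitIRInputsDefs
import Summits.QuantumFields.YangMills.Theorems.MirrorModularBoostsHypercubicLimitNontrivialClause
import Summits.QuantumFields.YangMills.Theorems.MirrorModularBoostsHypercubicLimitNonGaussianClause

/-!
# Line `Sketch` (coupling response), closure step Z3a: non-triviality, non-Gaussianity and the lattice gap along the sub-scheme

Crux `stmt-QuantumFields-16154` (`HypercubicLimit`), line `Sketch`, reshape 4.  Given a `PlaneLimits r sch φ T` package and the IR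
inputs along `sch`: the candidate family `planeSum T` satisfies the crux's non-triviality and non-Gaussianity clauses (floors (c), (d)
of `IRInputs` restricted to the subsequence + the convergence clause along the sub-scheme, `convergence_subseq_of_planeLimits`, fed to the
landed `nontrivialClause_of_latticeFloor` / `nonGaussianClause_of_latticeFloor`), and the sub-scheme keeps the uniform lattice gap.
-/

noncomputable section

open scoped SchwartzMap
open MeasureTheory Filter Topology
open Literature.MathematicalPhysics.AQFT Literature.MathematicalPhysics.QuantumLattice
open Literature.MathematicalPhysics.QuantumFieldTheory

namespace Summit.QuantumFields.YangMills.Cruxes.HypercubicLimit.CouplingResponse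

/-- **Registered sub-goal `softFloors_subseq` (Z3a)**: along a `PlaneLimits` package with the IR inputs, `planeSum T` is non-trivial
and non-Gaussian in the crux's sense, and the sub-scheme keeps every uniform lattice gap of the scheme. [folklore] -/
theorem softFloors_subseq :
    ∀ (G : Type) [Group G] [TopologicalSpace G] [IsTopologicalGroup G] [CompactSpace G] [MeasurableSpace G] [BorelSpace G] (r : LatticeRep G) (sch : SpeciesScheme (YMSpecies G)) (φ : ℕ → ℕ) (hφ : StrictMono φ) (T : (n : ℕ) → (Fin n → Plane) → (𝓢((Fin n → EuclideanSpace ℝ (Fin 4)), ℂ) →L[ℂ] ℂ)), PlaneLimits r sch φ T → IRInputs r sch → (∃ (F₁ G₁ : 𝓢((Fin 1 → EuclideanSpace ℝ (Fin 4)), ℂ)) (H₁ : 𝓢((Fin (1 + 1) → EuclideanSpace ℝ (Fin 4)), ℂ)), IsTimeOrdered F₁ ∧ IsTimeOrdered G₁ ∧ IsAppendTensorOf H₁ (osAdjoint F₁) G₁ ∧ (planeSum T).toLabelled (1 + 1) (fun _ => ()) H₁ ≠ (planeSum T).toLabelled 1 (fun _ => ()) (osAdjoint F₁) * (planeSum T).toLabelled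 1 (fun _ => ()) G₁) ∧ (∃ (f g h : 𝓢(EuclideanSpace ℝ (Fin 4), ℂ)) (Ffgh : 𝓢((Fin 3 → EuclideanSpace ℝ (Fin 4)), ℂ)) (Fgh Ffh Ffg : 𝓢((Fin 2 → EuclideanSpace ℝ (Fin 4)), ℂ)) (Ff Fg Fh : 𝓢((Fin 1 → EuclideanSpace ℝ (Fin 4)), ℂ)), IsTensorOf Ffgh ![f, g, h] ∧ IsOffDiagonal Ffgh ∧ IsTensorOf Fgh ![g, h] ∧ IsTensorOf Ffh ![f, h] ∧ IsTensorOf Ffg ![f, g] ∧ IsTensorOf Ff ![f] ∧ IsTensorOf Fg ![g] ∧ IsTensorOf Fh ![h] ∧ (planeSum T).toLabelled 3 (fun _ => ()) Ffgh - (planeSum T).toLabelled 1 (fun _ => ()) Ff * (planeSum T).toLabelled 2 (fun _ => ()) Fgh - (planeSum T).toLabelled 1 (fun _ => ()) Fg * (planeSum T).toLabelled 2 (fun _ => ()) Ffh - (planeSum T).toLabelled 1 (fun _ => ()) Fh * (planeSum T).toLabelled 2 (fun _ => ()) Ffg + 2 * ((planeSum T).toLabelled 1 (fun _ => ()) Ff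 * (planeSum T).toLabelled 1 (fun _ => ()) Fg * (planeSum T).toLabelled 1 (fun _ => ()) Fh) ≠ 0) ∧ (∀ Δ : ℝ, HasLatticeMassGap r sch Δ → HasLatticeMassGap r (subseq sch φ hφ) Δ) := by
  intro G _ _ _ _ _ _ r sch φ hφ T hPL hIR
  have hconv := convergence_subseq_of_planeLimits G r sch φ hφ T hPL
  have hIR' := irInputs_subseq G r sch φ hφ hIR
  obtain ⟨-, hNTfloor, hNGfloor⟩ := hIR'
  exact ⟨nontrivialClause_of_latticeFloor G r (subseq sch φ hφ) (planeSum T) hconv hNTfloor,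
    nonGaussianClause_of_latticeFloor G r (subseq sch φ hφ) (planeSum T) hconv hNGfloor,
    fun Δ h => hasLatticeMassGap_subseq r sch φ hφ h⟩

end Summit.QuantumFields.YangMills.Cruxes.HypercubicLimit.CouplingResponse

end
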